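import Summits.BirchSwinnertonDyer.Rank1Residual.Additive.XMultRankZeroCyclotomicPrime
import Summits.BirchSwinnertonDyer.Rank1Residual.Additive.CyclotomicPrimeMultiplicativeReduction
import Summits.BirchSwinnertonDyer.Rank1Residual.X2.AnalyticInvariants
import Literature.NumberTheory.EllipticCurves.Greenberg1999.EulerCharacteristicNumberFieldSplitMultiplicative
import Literature.NumberTheory.EllipticCurves.PAdicHeightsLInvariantHoldsProofs
import Literature.NumberTheory.EllipticCurves.IwasawaLeadingTermProofs
import Literature.NumberTheory.EllipticCurves.PAdicLFunctionNonsplitMultiplicativeExistenceProofs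
import Literature.NumberTheory.EllipticCurves.PAdicBSDSplitMultiplicativeProofs
import HarnessLib

/-!
# Line V19b, the two local types: NON-SPLIT and SPLIT multiplicative twist `V = W^{(p*)}` at an odd `p`,
# ranks `(0,0)`, over `F = ℚ(ζ_p)` — instances of the abstract core, and Greenberg's displays over
# `F` derived from the named facts (cell `b2b-bsdres`, seat additive-p4)

HONEST FRAMING (cell `b2b-bsdres`, run/shared/lean/b2b/bsd-rank1-residual/, verbatim in every
file): the goal of the cell is to DELETE the COMBINATION-SHAPED residual classes of the
Birch–Swinnerton-Dyer formula for ALL analytic-rank `≤ 1` elliptic curves over `ℚ` — "full BSD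
formula for every rank `≤ 1` curve in class `C`" assembled STRICTLY from published theorems — so
that the rank-`≤ 1` remainder becomes exactly the CONSTRUCTION-SHAPED classes, which are TYPED
(missing-input `Prop`s), NOT attempted. This is not "finishing BSD". Seat additive-p4 (research route
on X3/X4); the labels of X3 and X4 are UNCHANGED by this file; nothing is booked here.

Theorems only (no `def`, no `sorry`, no new named fact). Contents:
* `not_dvd_ramificationIdx_mul_inertiaDeg_cyclotomicPrime` — `e(𝔭|p)·f(𝔭|p) = (p−1)·1` is prime to
  `p` for `F = ℚ(ζ_p)` (Mathlib), the degree hypothesis of Greenberg's split display;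
* `XMultCyclotomicPrime.greenbergF_nonsplit_of_fact` / `…greenbergF_split_of_fact` — the inline
  hypotheses `hGrF` of the two instances DERIVED from the named facts
  `Greenberg1999.thm41Analogue_charValue_rankZero_numberField` (A103; `l_𝔭 = 1`) resp.
  `Greenberg1999.thm41Analogue_charValue_rankZero_split_baseChange` (A106; `l_𝔭 = 𝓛_p(V)/(2p)`) at
  the unique prime of `ℚ(ζ_p)` above `p` (tree `exists_unique_prime_mult_reduction_data`);
* `XNonsplitMultCyclotomicPrime.exists_padicVal_shaOrder_add_le` — the abstract core with
  `L♯ = L` (`IsMultPAdicLFunctionOf f p (−1) L`, `L(0) = 2[0]⁺_f`), `λ = μ = 1`, `e = 2`;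
* `XSplitMultCyclotomicPrime.exists_padicVal_shaOrder_add_le` — the abstract core with `L♯ = L/T`
  (`L(0) = 0`, `[T¹]L·log_p γ_cyc = e⁺·𝓛_p(V)·[0]⁺_f`: the Greenberg–Stevens shape), `μ = log_p γ_cyc`
  (`= p·unit`, tree `exists_unit_padicLog_cyclotomicGenerator`; `ord_p 2 = 0`: tree `X2.valuation_two_eq_zero`), `e = e⁺·2p`, `λ = 𝓛_p(V)/(2p)`; the
  divisibility hypothesis is the printed `I`-shape `ι(T·g) = u ϖ^m ϖ'^m · L · ∏_{0<i} B_i`.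
The same inequality results in both cases (the `𝓛`-invariant and the two factors of `p`-adic order
one cancel, as the main conjecture predicts).
-/

noncomputable section

open scoped Classical MatrixGroups ModularForm

open CongruenceSubgroup WeierstrassCurve NumberField IsDedekindDomain
  Literature.NumberTheory.EllipticCurves Literature.NumberTheory.EllipticCurves.ModularForms
  Literature.NumberTheory.EllipticCurves.Rank1Residual
  Literature.NumberTheory.EllipticCurves.Rank1Residual.Typed
  Literature.NumberTheory.GaloisRepresentations

namespace Summit.BirchSwinnertonDyer.Rank1Residual.Additive

/-! ## §1 `ℚ(ζ_p)`-side bookkeeping -/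

section Degree

variable (p : ℕ) [hp : Fact p.Prime] (F : Type) [Field F] [NumberField F] [IsCyclotomicExtension {p} ℚ F]

/-- For `F = ℚ(ζ_p)` and the prime `𝔭 ∋ p`: `e(𝔭|p)·f(𝔭|p) = (p − 1)·1` is prime to `p` (Mathlib
`IsCyclotomicExtension.Rat.ramificationIdx_eq_of_prime` / `inertiaDeg_eq_of_prime`) — the degree
hypothesis of `Greenberg1999.thm41Analogue_charValue_rankZero_split_baseChange`. [folklore] -/
theorem not_dvd_ramificationIdx_mul_inertiaDeg_cyclotomicPrime (𝔭 : HeightOneSpectrum (𝓞 F))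
    (hmem : ((p : ℕ) : 𝓞 F) ∈ 𝔭.asIdeal) :
    ¬ p ∣ 𝔭.asIdeal.ramificationIdx ℤ * 𝔭.asIdeal.inertiaDeg ℤ := by
  haveI : 𝔭.asIdeal.LiesOver (Ideal.span {((p : ℕ) : ℤ)}) :=
    Ideal.liesOver_span_of_natCast_mem' hp.out hmem
  rw [IsCyclotomicExtension.Rat.ramificationIdx_eq_of_prime p F 𝔭.asIdeal,
    IsCyclotomicExtension.Rat.inertiaDeg_eq_of_prime p F 𝔭.asIdeal, mul_one]
  intro h
  have h1 : p ≤ p - 1 := Nat.le_of_dvd (by have := hp.out.two_le; omega) h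
  have h2 := hp.out.two_le
  omega

end Degree

/-! ## §2 Greenberg's displays over `F = ℚ(ζ_p)` from the named facts -/

section GreenbergF

variable (p : ℕ) [hp : Fact p.Prime] (F : Type) [Field F] [NumberField F] [IsCyclotomicExtension {p} ℚ F]
  (V : WeierstrassCurve ℚ) [V.IsElliptic] [V.IsGloballyMinimal]

/-- **Greenberg's Euler characteristic for `V_F`, `F = ℚ(ζ_p)`, at the NON-SPLIT multiplicative prime
above `p`** (the inline hypothesis `hGrF` of `XNonsplitMultCyclotomicPrime.…`, with `λ = 1`), DERIVED
from the named fact `Greenberg1999.thm41Analogue_charValue_rankZero_numberField` (LNM 1716 pp. 112–113,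
"`l_v = 1`" at a non-split `v ∣ p`, `p` odd): the only prime of `F` above `p` is `𝔭 = (ζ_p − 1)`
(`N𝔭 = p`) and `V_F` is non-split multiplicative there (tree `exists_unique_prime_mult_reduction_data`).
[cite: GreenbergLNM1716, §4 pp. 112–113] -/
theorem XMultCyclotomicPrime.greenbergF_nonsplit_of_fact
    (hGr : Greenberg1999.thm41Analogue_charValue_rankZero_numberField) (hp2 : p ≠ 2)
    (hmult : V.HasMultiplicativeReductionAtPrime p) (hns : ¬ V.HasSplitMultiplicativeReductionAtPrime p) :
    ∀ (κ : ZpExtension F p) (γ : Field.absoluteGaloisGroup F),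
        κ.IsCyclotomic → κ.IsTopGenerator γ →
      ∀ (D : (V.baseChange F).SelmerDualData κ γ) [Module.Finite (IwasawaAlgebra p) D.X], D.IsTorsion →
      ∀ (fE : IwasawaAlgebra p), D.charIdeal = Ideal.span {fE} →
        Finite ((V.baseChange F).selmerGroupPInfty p) →
        ∃ u : ℤ_[p]ˣ,
          ((PowerSeries.constantCoeff fE : ℤ_[p]) : ℚ_[p]) *
              (Nat.card (AddCommGroup.primaryComponent (V.baseChange F).toAffine.Point p) : ℚ_[p]) ^ 2 =
            ((u : ℤ_[p]) : ℚ_[p]) * 1 * (p : ℚ_[p]) ^ (padicValNat p (V.baseChange F).tamagawaProduct) *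
              (Nat.card ((V.baseChange F).selmerGroupPInfty p) : ℚ_[p]) := by
  intro κ γ hκ hγ D _ hX fE hfE hfin
  haveI : (V.baseChange F).IsElliptic := by rw [baseChange]; infer_instance
  obtain ⟨𝔭, -, hS, -, -, hmultF, hnsF, -⟩ := exists_unique_prime_mult_reduction_data p F V hmult
  obtain ⟨u, hu⟩ := hGr.of_unique_prime_nonsplit (V.baseChange F) p hp2 𝔭 hS hmultF (hnsF hns) κ γ hκ hγ
    D hX fE hfE hfin
  exact ⟨u, by rw [hu, mul_one]⟩

omit [V.IsGloballyMinimal] in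
/-- `log_p q_V ≠ 0` for a Tate parameter datum (`𝓛_p(V) = log_p q/ord_p q ≠ 0`, tree
`LInvariant_ne_zero_holds`: Barré-Sirieix–Diaz–Gramain–Philibert).
[cite: BarreSirieixDiazGramainPhilibert1996Manin, Thm. 1] -/
theorem padicLog_tateParameter_ne_zero_prime (Dq : TateParameterData V p) : padicLog p Dq.q ≠ 0 := by
  intro h
  apply LInvariant_ne_zero_holds (W := V) (p := p) Dq
  rw [LInvariant, h, zero_div]

/-- **Greenberg's Euler characteristic for `V_F`, `F = ℚ(ζ_p)`, at the SPLIT multiplicative prime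
above `p`** (the inline hypothesis `hGrF` of `XSplitMultCyclotomicPrime.…`, `λ = 𝓛_p(V)/(2p)`), DERIVED
from the named fact `Greenberg1999.thm41Analogue_charValue_rankZero_split_baseChange` (LNM 1716
pp. 112–113 + p. 94, base change of a `ℚ`-curve at a place of degree prime to `p`): the only prime of
`F` above `p` is `𝔭` (`e·f = (p−1)·1` prime to `p`), `V_F` is split multiplicative there, and
`log_p q_V ≠ 0`. [cite: GreenbergLNM1716, §4 pp. 112–113 and §3 p. 94] -/
theorem XMultCyclotomicPrime.greenbergF_split_of_fact
    (hGr : Greenberg1999.thm41Analogue_charValue_rankZero_split_baseChange) (hp2 : p ≠ 2)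
    (Dq : TateParameterData V p) :
    ∀ (κ : ZpExtension F p) (γ : Field.absoluteGaloisGroup F),
        κ.IsCyclotomic → κ.IsTopGenerator γ →
      ∀ (D : (V.baseChange F).SelmerDualData κ γ) [Module.Finite (IwasawaAlgebra p) D.X], D.IsTorsion →
      ∀ (fE : IwasawaAlgebra p), D.charIdeal = Ideal.span {fE} →
        Finite ((V.baseChange F).selmerGroupPInfty p) →
        ∃ u : ℤ_[p]ˣ,
          ((PowerSeries.constantCoeff fE : ℤ_[p]) : ℚ_[p]) *
              (Nat.card (AddCommGroup.primaryComponent (V.baseChange F).toAffine.Point p) : ℚ_[p]) ^ 2 =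
            ((u : ℤ_[p]) : ℚ_[p]) * (LInvariant Dq / (2 * (p : ℚ_[p]))) *
              (p : ℚ_[p]) ^ (padicValNat p (V.baseChange F).tamagawaProduct) *
              (Nat.card ((V.baseChange F).selmerGroupPInfty p) : ℚ_[p]) := by
  intro κ γ hκ hγ D _ hX fE hfE hfin
  haveI : (V.baseChange F).IsElliptic := by rw [baseChange]; infer_instance
  obtain ⟨𝔭, hmem, hS, -, -, -, -, hsplitF⟩ :=
    exists_unique_prime_mult_reduction_data p F V Dq.split.hasMultiplicativeReductionAtPrime
  exact hGr.of_unique_prime V p Dq hp2 (padicLog_tateParameter_ne_zero_prime p V Dq) 𝔭 hS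
    (hsplitF Dq.split) (not_dvd_ramificationIdx_mul_inertiaDeg_cyclotomicPrime p F 𝔭 hmem) κ γ hκ hγ D hX
    fE hfE hfin

end GreenbergF

/-! ## §3 The two instances of the abstract core -/

section Instances

variable (p : ℕ) [hp : Fact p.Prime] (F : Type) [Field F] [NumberField F] [IsCyclotomicExtension {p} ℚ F]
  (V : WeierstrassCurve ℚ) [V.IsElliptic] [V.IsGloballyMinimal]
  (W : WeierstrassCurve ℚ) [W.IsElliptic] [W.IsGloballyMinimal]

/-- **Core theorem, NON-SPLIT multiplicative twist (line V19b, odd `p`, rank `0 + 0`, all branches over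
`F = ℚ(ζ_p)`).** Let `V/ℚ` be globally minimal, NON-SPLIT multiplicative at the odd prime `p`
(`a_p = −1`), `W = C • V^{(p*)}` globally minimal ADDITIVE at `p`, both of analytic rank `0`; `f` the
newform of `V`, `ϖ·Ω_V = Ω⁺_f`, `ϖ'·|Ω⁻(V)| = Ω⁻_f`; `L` THE even branch `ω⁰` of `L_p(V)`
(`IsMultPAdicLFunctionOf f p (−1) L`: constant term `2[0]⁺_f`, no exceptional zero); `B_i` the other
tame branches of the one-term measure. ASSUME, over `F`: `hDivF` (the shape of the named facts
`Wuthrich2014.thm16_charIdeal_dvd_nonsplitMultiplicative_cyclotomicPrime` /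
`…kato_charIdeal_dvd_nonsplitMultiplicative_cyclotomicPrime_of_surjective`): `X(V/F_∞)` torsion and
`ι g = u ϖ^m ϖ'^m · L · ∏_{0<i<p−1} B_i`; `hGrF` (the shape of `greenbergF_nonsplit_of_fact`, i.e.
Greenberg's non-split display `l_𝔭 = 1`); `hO` (other branch values non-zero). THEN (hGZK, hmod):
**`ord_p #Ш(V) + ord_p #Ш(W) + ord_p ∏_w c_w(V_F) + 2(ord_p #V(ℚ) + ord_p #W(ℚ)) ≤ ord_p q_V + ord_p q_W
+ ord_p ∏c(V) + ord_p ∏c(W) + 2 ord_p #V(F) + v(o) + m(ord_p ϖ + ord_p ϖ') − ord_p ϖ − ord_p ϖ_mid`**.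
[cite: Wuthrich2014, Thm. 16 (p. 397), Thm. 3 (p. 383)] [cite: GreenbergLNM1716, §4 pp. 112–113]
[cite: MazurTateTeitelbaum1986Invent, §I.10, §I.13–I.14] -/
theorem XNonsplitMultCyclotomicPrime.exists_padicVal_shaOrder_add_le
    (hGZK : rank_eq_analyticRank_of_analyticRank_le_one) (hmod : hasEntireLFunction_rat)
    (hp2 : p ≠ 2) (C : VariableChange ℚ) (hC : C • V.quadraticTwist ((-1 : ℚ) ^ (p / 2) * p) = W)
    (hmult : V.HasMultiplicativeReductionAtPrime p) (hns : ¬ V.HasSplitMultiplicativeReductionAtPrime p)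
    (hadd : Addv W p) (hrV : V.analyticRank = 0) (hrW : W.analyticRank = 0)
    {N : ℕ} [NeZero N] {f : CuspForm (Gamma0 N) 2} (hf : IsNewformOf V f)
    (ϖ ϖ' : ℚ) (hϖ : (ϖ : ℝ) * V.realPeriodRat = plusPeriod f)
    (hϖ' : (ϖ' : ℝ) * V.imaginaryPeriodRat = minusPeriod f)
    (L : PowerSeries ℚ_[p]) (hL : IsMultPAdicLFunctionOf f p (-1) L)
    (hDivF : ∀ (κ : ZpExtension F p) (γ : Field.absoluteGaloisGroup F),
      κ.IsCyclotomic → κ.IsTopGenerator γ →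
      (∃ ζ : ℤ_[p]ˣ, IsOfFinOrder ζ ∧
        ((GaloisRep.cyclotomicCharacter F p γ * ζ : ℤ_[p]ˣ) : ℤ_[p]) = (cyclotomicGenerator p : ℤ_[p])) →
      ∀ D : (V.baseChange F).SelmerDualData κ γ,
        D.IsTorsion ∧ ∃ g ∈ D.charIdeal, ∃ u : ℤ_[p]ˣ,
          iwasawaToPowerSeries p g =
            PowerSeries.C (((u : ℤ_[p]) : ℚ_[p]) * (ϖ : ℚ_[p]) ^ (p / 2) * (ϖ' : ℚ_[p]) ^ (p / 2)) *
              (L * ∏ i ∈ Finset.Ico 1 (p - 1),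
                (if Even i then padicLFunctionPlusBranchMult f (-1 : ℚ_[p]) i
                  else padicLFunctionMinusBranchMult f (-1 : ℚ_[p]) i)))
    (hGrF : ∀ (κ : ZpExtension F p) (γ : Field.absoluteGaloisGroup F),
        κ.IsCyclotomic → κ.IsTopGenerator γ →
      ∀ (D : (V.baseChange F).SelmerDualData κ γ) [Module.Finite (IwasawaAlgebra p) D.X], D.IsTorsion →
      ∀ (fE : IwasawaAlgebra p), D.charIdeal = Ideal.span {fE} →
        Finite ((V.baseChange F).selmerGroupPInfty p) →
        ∃ u : ℤ_[p]ˣ,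
          ((PowerSeries.constantCoeff fE : ℤ_[p]) : ℚ_[p]) *
              (Nat.card (AddCommGroup.primaryComponent (V.baseChange F).toAffine.Point p) : ℚ_[p]) ^ 2 =
            ((u : ℤ_[p]) : ℚ_[p]) * 1 * (p : ℚ_[p]) ^ (padicValNat p (V.baseChange F).tamagawaProduct) *
              (Nat.card ((V.baseChange F).selmerGroupPInfty p) : ℚ_[p]))
    (hO : (∏ i ∈ (Finset.Ico 1 (p - 1)).erase (p / 2),
        PowerSeries.constantCoeff
          (if Even i then padicLFunctionPlusBranchMult f (-1 : ℚ_[p]) i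
            else padicLFunctionMinusBranchMult f (-1 : ℚ_[p]) i)) ≠ 0) :
    ∃ qV qW : ℚ, shaAn V = (qV : ℂ) ∧ shaAn W = (qW : ℂ) ∧
      (padicValNat p V.shaOrder : ℤ) + padicValNat p W.shaOrder +
            padicValNat p (V.baseChange F).tamagawaProduct +
            2 * (padicValNat p (Nat.card V.toAffine.Point) + padicValNat p (Nat.card W.toAffine.Point)) ≤
        padicValRat p qV + padicValRat p qW +
          padicValNat p V.tamagawaProduct + padicValNat p W.tamagawaProduct +
          2 * padicValNat p (Nat.card (V.baseChange F).toAffine.Point) +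
          (∏ i ∈ (Finset.Ico 1 (p - 1)).erase (p / 2),
              PowerSeries.constantCoeff
                (if Even i then padicLFunctionPlusBranchMult f (-1 : ℚ_[p]) i
                  else padicLFunctionMinusBranchMult f (-1 : ℚ_[p]) i)).valuation +
          ((p / 2 : ℕ) : ℤ) * (padicValRat p ϖ + padicValRat p ϖ') - padicValRat p ϖ -
          (if p % 4 = 1 then padicValRat p ϖ else padicValRat p ϖ') := by
  obtain ⟨hap, hpN⟩ := hf.cuspCoeff_eq_neg_one_and_dvd_of_nonsplit hmult hns
  have hap' : cuspCoeff f p = ((-1 : ℤ) : ℂ) := by rw [hap]; norm_num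
  have hcast : ((-1 : ℤ) : ℚ_[p]) = -1 := by norm_num
  have hLs : PowerSeries.constantCoeff L * 1 = 2 * 1 * (ratPlusSymbol f 0 : ℚ_[p]) := by
    rw [mul_one, mul_one, hL.constantCoeff_of_neg_one]
  have h := XMultCyclotomicPrime.exists_padicVal_shaOrder_add_le p F V W hGZK hmod hp2 C hC hmult hadd hrV
    hrW hf hpN hap' (Or.inr rfl) ϖ ϖ' hϖ hϖ' L 1 1 2 one_ne_zero one_ne_zero two_ne_zero
    (by rw [Padic.valuation_one, X2.valuation_two_eq_zero hp2]) hLs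
  simp only [hcast] at h
  exact h hDivF hGrF hO

/-- **Core theorem, SPLIT multiplicative twist (line V19b, odd `p`, rank `0 + 0`, all branches over
`F = ℚ(ζ_p)`; exceptional zero).** Let `V/ℚ` be globally minimal, SPLIT multiplicative at the odd
prime `p` (Tate datum `Dq`, `𝓛 = LInvariant Dq`), `W = C • V^{(p*)}` globally minimal ADDITIVE at `p`,
both of analytic rank `0`; `f` the newform of `V`, `ϖ·Ω_V = Ω⁺_f`, `ϖ'·|Ω⁻(V)| = Ω⁻_f`; `L ∈ ℚ_p⟦T⟧`
ANY power series with `L(0) = 0` and `[T¹]L · log_p γ_cyc = e⁺·𝓛·[0]⁺_f` for a unit `e⁺` (for the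
branch `ω⁰` of `L_p(V)`: Greenberg–Stevens, `e⁺ = 1`); `B_i` the other tame branches of the one-term
measure (`α = 1`). ASSUME, over `F`: `hDivF` (the shape of the named facts
`Wuthrich2014.thm16_charIdeal_dvd_splitMultiplicative_cyclotomicPrime` /
`…kato_charIdeal_dvd_splitMultiplicative_cyclotomicPrime_of_surjective`, the printed `I`-clause):
`X(V/F_∞)` torsion and `ι(T·g) = u ϖ^m ϖ'^m · L · ∏_{0<i<p−1} B_i`; `hGrF` (the shape of
`greenbergF_split_of_fact`, Greenberg's split display `l_𝔭 = 𝓛/(2p)`); `hO`. THEN (hGZK, hmod):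
**`ord_p #Ш(V) + ord_p #Ш(W) + ord_p ∏_w c_w(V_F) + 2(ord_p #V(ℚ) + ord_p #W(ℚ)) ≤ ord_p q_V + ord_p q_W
+ ord_p ∏c(V) + ord_p ∏c(W) + 2 ord_p #V(F) + v(o) + m(ord_p ϖ + ord_p ϖ') − ord_p ϖ − ord_p ϖ_mid`** —
the `𝓛`-invariants and the two factors of `p`-adic order one (`log_p γ_cyc`, `2p`) cancel.
[cite: Wuthrich2014, Thm. 16 (p. 397), Cor. 19 (pp. 398–399)] [cite: GreenbergLNM1716, §4 pp. 112–113, §3 p. 94]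
[cite: Kobayashi2006DocMath, Cor. 4.2 (p. 575)] [cite: MazurTateTeitelbaum1986Invent, §I.10, §I.13–I.14] -/
theorem XSplitMultCyclotomicPrime.exists_padicVal_shaOrder_add_le
    (hGZK : rank_eq_analyticRank_of_analyticRank_le_one) (hmod : hasEntireLFunction_rat)
    (hp2 : p ≠ 2) (C : VariableChange ℚ) (hC : C • V.quadraticTwist ((-1 : ℚ) ^ (p / 2) * p) = W)
    (Dq : TateParameterData V p) (hadd : Addv W p) (hrV : V.analyticRank = 0) (hrW : W.analyticRank = 0)
    {N : ℕ} [NeZero N] {f : CuspForm (Gamma0 N) 2} (hf : IsNewformOf V f)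
    (ϖ ϖ' : ℚ) (hϖ : (ϖ : ℝ) * V.realPeriodRat = plusPeriod f)
    (hϖ' : (ϖ' : ℝ) * V.imaginaryPeriodRat = minusPeriod f)
    (L : PowerSeries ℚ_[p]) (ep : ℤ_[p]ˣ) (hL0 : PowerSeries.constantCoeff L = 0)
    (hL1 : PowerSeries.coeff 1 L * padicLog p (cyclotomicGenerator p : ℚ_[p]) =
      ((ep : ℤ_[p]) : ℚ_[p]) * LInvariant Dq * (ratPlusSymbol f 0 : ℚ_[p]))
    (hDivF : ∀ (κ : ZpExtension F p) (γ : Field.absoluteGaloisGroup F),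
      κ.IsCyclotomic → κ.IsTopGenerator γ →
      (∃ ζ : ℤ_[p]ˣ, IsOfFinOrder ζ ∧
        ((GaloisRep.cyclotomicCharacter F p γ * ζ : ℤ_[p]ˣ) : ℤ_[p]) = (cyclotomicGenerator p : ℤ_[p])) →
      ∀ D : (V.baseChange F).SelmerDualData κ γ,
        D.IsTorsion ∧ ∃ g ∈ D.charIdeal, ∃ u : ℤ_[p]ˣ,
          iwasawaToPowerSeries p (PowerSeries.X * g) =
            PowerSeries.C (((u : ℤ_[p]) : ℚ_[p]) * (ϖ : ℚ_[p]) ^ (p / 2) * (ϖ' : ℚ_[p]) ^ (p / 2)) *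
              (L * ∏ i ∈ Finset.Ico 1 (p - 1),
                (if Even i then padicLFunctionPlusBranchMult f (1 : ℚ_[p]) i
                  else padicLFunctionMinusBranchMult f (1 : ℚ_[p]) i)))
    (hGrF : ∀ (κ : ZpExtension F p) (γ : Field.absoluteGaloisGroup F),
        κ.IsCyclotomic → κ.IsTopGenerator γ →
      ∀ (D : (V.baseChange F).SelmerDualData κ γ) [Module.Finite (IwasawaAlgebra p) D.X], D.IsTorsion →
      ∀ (fE : IwasawaAlgebra p), D.charIdeal = Ideal.span {fE} →
        Finite ((V.baseChange F).selmerGroupPInfty p) →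
        ∃ u : ℤ_[p]ˣ,
          ((PowerSeries.constantCoeff fE : ℤ_[p]) : ℚ_[p]) *
              (Nat.card (AddCommGroup.primaryComponent (V.baseChange F).toAffine.Point p) : ℚ_[p]) ^ 2 =
            ((u : ℤ_[p]) : ℚ_[p]) * (LInvariant Dq / (2 * (p : ℚ_[p]))) *
              (p : ℚ_[p]) ^ (padicValNat p (V.baseChange F).tamagawaProduct) *
              (Nat.card ((V.baseChange F).selmerGroupPInfty p) : ℚ_[p]))
    (hO : (∏ i ∈ (Finset.Ico 1 (p - 1)).erase (p / 2),
        PowerSeries.constantCoeff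
          (if Even i then padicLFunctionPlusBranchMult f (1 : ℚ_[p]) i
            else padicLFunctionMinusBranchMult f (1 : ℚ_[p]) i)) ≠ 0) :
    ∃ qV qW : ℚ, shaAn V = (qV : ℂ) ∧ shaAn W = (qW : ℂ) ∧
      (padicValNat p V.shaOrder : ℤ) + padicValNat p W.shaOrder +
            padicValNat p (V.baseChange F).tamagawaProduct +
            2 * (padicValNat p (Nat.card V.toAffine.Point) + padicValNat p (Nat.card W.toAffine.Point)) ≤
        padicValRat p qV + padicValRat p qW +
          padicValNat p V.tamagawaProduct + padicValNat p W.tamagawaProduct +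
          2 * padicValNat p (Nat.card (V.baseChange F).toAffine.Point) +
          (∏ i ∈ (Finset.Ico 1 (p - 1)).erase (p / 2),
              PowerSeries.constantCoeff
                (if Even i then padicLFunctionPlusBranchMult f (1 : ℚ_[p]) i
                  else padicLFunctionMinusBranchMult f (1 : ℚ_[p]) i)).valuation +
          ((p / 2 : ℕ) : ℤ) * (padicValRat p ϖ + padicValRat p ϖ') - padicValRat p ϖ -
          (if p % 4 = 1 then padicValRat p ϖ else padicValRat p ϖ') := by
  have hsplit : V.HasSplitMultiplicativeReductionAtPrime p := Dq.split
  have hmult : V.HasMultiplicativeReductionAtPrime p := hsplit.hasMultiplicativeReductionAtPrime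
  have hap : cuspCoeff f p = ((1 : ℤ) : ℂ) := by rw [(hf.cuspCoeff_eq_one_and_sq_of_split hsplit).1]; norm_num
  have hpN : p ∣ N := hf.dvd_level_of_split hsplit
  have hcast : ((1 : ℤ) : ℚ_[p]) = 1 := by norm_num
  have hp0 : (p : ℚ_[p]) ≠ 0 := by exact_mod_cast hp.out.ne_zero
  have hLinv : LInvariant Dq ≠ 0 := LInvariant_ne_zero_holds (W := V) (p := p) Dq
  -- the deflated even branch `L = T · L♭`
  set Lb : PowerSeries ℚ_[p] := PowerSeries.mk fun n ↦ PowerSeries.coeff (n + 1) L with hLb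
  have hLX : L = PowerSeries.X * Lb := by
    have h := PowerSeries.eq_X_mul_shift_add_const L
    rw [hL0, map_zero, add_zero] at h
    exact h
  have hLb0 : PowerSeries.constantCoeff Lb = PowerSeries.coeff 1 L := by
    rw [← PowerSeries.coeff_zero_eq_constantCoeff_apply, hLb, PowerSeries.coeff_mk]
  -- `μ = log_p γ_cyc = p · unit`, `e = e⁺ · 2p`, `λ = 𝓛/(2p)`
  set ℓ : ℚ_[p] := padicLog p (cyclotomicGenerator p : ℚ_[p]) with hℓ
  obtain ⟨uℓ, huℓ⟩ := exists_unit_padicLog_cyclotomicGenerator p hp2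
  have hℓ0 : ℓ ≠ 0 := by rw [hℓ, huℓ]; exact mul_ne_zero hp0 (coe_units_ne_zero p uℓ)
  have hvℓ : ℓ.valuation = 1 := by
    rw [hℓ, huℓ, Padic.valuation_mul hp0 (coe_units_ne_zero p uℓ), Padic.valuation_p,
      valuation_coe_units_eq_zero, add_zero]
  set e : ℚ_[p] := ((ep : ℤ_[p]) : ℚ_[p]) * (2 * (p : ℚ_[p])) with he
  have h20 : (2 : ℚ_[p]) ≠ 0 := two_ne_zero
  have he0 : e ≠ 0 := by rw [he]; exact mul_ne_zero (coe_units_ne_zero p ep) (mul_ne_zero h20 hp0)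
  have hve : e.valuation = 1 := by
    rw [he, Padic.valuation_mul (coe_units_ne_zero p ep) (mul_ne_zero h20 hp0), valuation_coe_units_eq_zero,
      Padic.valuation_mul h20 hp0, X2.valuation_two_eq_zero hp2, Padic.valuation_p]
    ring
  set lam : ℚ_[p] := LInvariant Dq / (2 * (p : ℚ_[p])) with hlam
  have hlam0 : lam ≠ 0 := by rw [hlam]; exact div_ne_zero hLinv (mul_ne_zero h20 hp0)
  have hLs : PowerSeries.constantCoeff Lb * ℓ = e * lam * (ratPlusSymbol f 0 : ℚ_[p]) := by
    rw [hLb0, hℓ, hL1, he, hlam]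
    field_simp
  -- the divisibility without the factor `T`
  have hDivF' : ∀ (κ : ZpExtension F p) (γ : Field.absoluteGaloisGroup F),
      κ.IsCyclotomic → κ.IsTopGenerator γ →
      (∃ ζ : ℤ_[p]ˣ, IsOfFinOrder ζ ∧
        ((GaloisRep.cyclotomicCharacter F p γ * ζ : ℤ_[p]ˣ) : ℤ_[p]) = (cyclotomicGenerator p : ℤ_[p])) →
      ∀ D : (V.baseChange F).SelmerDualData κ γ,
        D.IsTorsion ∧ ∃ g ∈ D.charIdeal, ∃ u : ℤ_[p]ˣ,
          iwasawaToPowerSeries p g =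
            PowerSeries.C (((u : ℤ_[p]) : ℚ_[p]) * (ϖ : ℚ_[p]) ^ (p / 2) * (ϖ' : ℚ_[p]) ^ (p / 2)) *
              (Lb * ∏ i ∈ Finset.Ico 1 (p - 1),
                (if Even i then padicLFunctionPlusBranchMult f (((1 : ℤ) : ℚ_[p])) i
                  else padicLFunctionMinusBranchMult f (((1 : ℤ) : ℚ_[p])) i)) := by
    intro κ γ hκ hγ hγ' D
    obtain ⟨hX, g, hg, u, hιg⟩ := hDivF κ γ hκ hγ hγ' D
    refine ⟨hX, g, hg, u, ?_⟩
    have hιX : iwasawaToPowerSeries p (PowerSeries.X * g) = PowerSeries.X * iwasawaToPowerSeries p g := by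
      rw [map_mul]
      simp [iwasawaToPowerSeries, PowerSeries.map_X]
    rw [hcast]
    apply mul_left_cancel₀ (PowerSeries.X_ne_zero (R := ℚ_[p]))
    rw [← hιX, hιg, hLX]
    ring
  have h := XMultCyclotomicPrime.exists_padicVal_shaOrder_add_le p F V W hGZK hmod hp2 C hC hmult hadd hrV
    hrW hf hpN hap (Or.inl rfl) ϖ ϖ' hϖ hϖ' Lb lam ℓ e hlam0 hℓ0 he0 (by rw [hvℓ, hve]) hLs hDivF'
  simp only [hcast] at h
  exact h hGrF hO

end Instances

end Summit.BirchSwinnertonDyer.Rank1Residual.Additive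

end
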